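import Summits.HodgeConjecture.HodgeConjecture.Theorems.NikulinTwinTransportRealMultiplicationWittCorrection
import Summits.HodgeConjecture.HodgeConjecture.Theorems.NikulinTwinTransportRealMultiplicationIntegralBasis
import Summits.HodgeConjecture.HodgeConjecture.Theorems.NikulinTwinTransportTwinSimilitudeAlgebraic
import Literature.AlgebraicGeometry.Surfaces.K3TwoZeroLine

/-!
# Route NikulinTwinTransport · `RealMultiplicationGlue` (stmt-HodgeConjecture-13681) —
# the glue WITHOUT the marking: from a rational `2`-self-similitude of `H²(S)` alone

The item `RealMultiplicationGlue := TwinSimilitudeAlgebraic → HodgeIsometryAlgebraic →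
TwinExists → LefschetzOneOneK3 → RealMultiplicationSqrtTwoAlgebraic` (Varesco 2023 Thm. 2.1 /
Rem. 2.2 with the twin in place of the Nikulin quotient). Earlier seats proved it from the named
fact `Huybrechts_K3_marking_exists` (`realMultiplicationGlue_of_marking`) and recorded why the
four hypotheses alone cannot give it in the tree: the Witt step needs the ISOMETRY CLASS of
`(H²(S, ℚ), ∪)` — precisely `H²(S, ℚ)(2) ≅ H²(S, ℚ)` — and X, Buskin, the universal twin relate `S`
only to OTHER surfaces while Lefschetz `(1,1)` is form-free. This file isolates that input in its
minimal, marking-free and ROUTE-EXPRESSIBLE form,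

  `K3TwoSelfSimilar`: every projective K3 surface `S` carries a `ℂ`-linear `Ξ : H²(S(ℂ); ℂ) →
  H²(S(ℂ); ℂ)` preserving rational classes with `(Ξx ∪ Ξy) = 2 (x ∪ y)`

(spelled in the route's own vocabulary — `complexBetti`, `IsRationalClass`, `cupProduct`, the
unfolded `IsK3Surface` —, so that a planner can inline it as a support hypothesis or as an extra
conjunct of `TwinExists` without importing any fact-carrying module), and proves:

* `realMultiplicationSqrtTwo_algebraic_of_twoSelfSimilitude` — for ONE projective K3 surface `S`
  with such a `Ξ`: X at the pair `(S, S)` and Lefschetz `(1,1)` on `S` make real multiplication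
  by `√2` algebraic. The marking of `realMultiplicationSqrtTwo_algebraic_of_markedK3` is replaced
  by the unconditional integral marking of a smooth projective surface (`exists_integralMarking`,
  arbitrary unimodular Gram matrix) and the Witt correction `exists_wittCorrection`; the Hodge
  bookkeeping uses the tree's unconditional `h^{2,0} ≤ 1` (`IsK3Surface.hodgeTypes_twoZero_zeroTwo`,
  `K3TwoZeroLine.lean`) instead of the marking's period clauses, the relation `eσ̄ = l̄σ̄`
  (a rational `e` commutes with conjugation, `conjClass_apply_of_isRationalClass`) instead of the
  Hodge–Riemann positivity `(σ.σ̄) > 0`, and treats `h^{2,0} = 0` as a degenerate case (then every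
  class is of type `(1,1)`, rational classes are algebraic, and `e = 0`).
* `realMultiplicationSqrtTwoAlgebraic_of_twoSelfSimilar`, `realMultiplicationGlue_of_twoSelfSimilar`
  — the route decls `RealMultiplicationSqrtTwoAlgebraic` and `RealMultiplicationGlue` from X,
  Lefschetz `(1,1)` and `K3TwoSelfSimilar` (Buskin and the twin are not used).
* `k3TwoSelfSimilar_of_marking` — `Huybrechts_K3_marking_exists` implies `K3TwoSelfSimilar`
  (`Ξ = η⁻¹ M η` for the lattice `2`-similitude `M`, `exists_twoSimilitude_k3Lattice`), so the
  new hypothesis is implied by the fact the route already rests on (via `TwinExists`); the sibling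
  `twoSelfSimilar_of_invariants` derives it from `b₂ = 22`, evenness and index `−16` alone.

Everything here is proved; no named fact is introduced. Prover seat prover-pitem-stmt-HodgeConjecture-13681-2.
-/

noncomputable section

namespace Summit.HodgeConjecture.HodgeConjecture.Theorems.NikulinTwinTransport

open scoped Manifold
open CategoryTheory Module MonoidalCategory
open Literature.AlgebraicGeometry Literature.AlgebraicGeometry.Motives
open Literature.AlgebraicGeometry.HodgeTheory Literature.AlgebraicGeometry.Surfaces
open Literature.Geometry.Kaehler
open Literature.AlgebraicTopology.SingularHomology

section PerSurface

variable {S : SchemeOver ℂ}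

/-- **Real multiplication by `√2` on ONE projective K3 surface `S` is algebraic, granted X at the
pair `(S, S)`, Lefschetz `(1,1)` on `S`, and a rational `2`-self-similitude `Ξ` of
`(H²(S(ℂ); ℂ), ∪)`** — the marking-free form of `realMultiplicationSqrtTwo_algebraic_of_markedK3`.
Proof. Take the integral marking `η, G, p₀` of the smooth projective surface `S`
(`exists_integralMarking`) and a Hodge model `A`. DEGENERATE CASE `h^{2,0} = 0`: every class is
`0 + y₁₁ + 0` (`exists_eq_lines_add_oneOne` with the zero lines), so every rational class is
algebraic (Lefschetz `(1,1)`), killed by `e`; rational classes span, so `e = 0 = [0]_*`.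
Otherwise fix `σ ≠ 0` of type `(2,0)`; `H^{2,0} = ℂσ`, `H^{0,2} = ℂσ̄`
(`IsK3Surface.hodgeTypes_twoZero_zeroTwo`), `eσ = lσ` and `eσ̄ = l̄σ̄` (`e` is rational, hence
commutes with conjugation). CASE `l = 0`: `e y = e y₁₁` is of type `(1,1)` for every `y`, so
`e (e x) = 0` for rational `x` (Lefschetz, `e|_{NS} = 0`), hence for all `x`, hence `NS^⊥ = 0`
(`e² = 2` there) and `e = 0`. CASE `l ≠ 0`: `NS ⊥ σ, σ̄` (`l (d.σ) = (ed.σ) = 0`) and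
`NS ⊆ H^{1,1}` (`isOfHodgeType_oneOne_of_ker`); the Witt correction `ν̃ = Σᵢ (·.aᵢ) bᵢ` of
`exists_wittCorrection` (built from `Ξ`; `aᵢ, bᵢ ∈ NS` rational) makes `Ξ₁ = e + ν̃` and its mirror
`Ξ₂ = −e + ν̃` rational, type-preserving `2`-similitudes of `H²(S)`
(`isOfHodgeType_add_correction'`, `cupProduct_neg_add_correction_eq'`); X at `(S, S)` gives
algebraic `γ₁, γ₂` with `Ξᵢ = [γᵢ]_*`, and `e = ½(Ξ₁ − Ξ₂) = [½(γ₁ − γ₂)]_*`.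
[cite: Varesco2023, Thm. 2.1 and Rem. 2.2] [cite: Huybrechts2019, §1]
[cite: Huybrechts2016K3, Ch. 1 (2.7) and Ch. 3 Def. 2.3] -/
theorem realMultiplicationSqrtTwo_algebraic_of_twoSelfSimilitude
    (μ : OrientationFamily) (S : SchemeOver ℂ) (hS : IsK3Surface S)
    (Ξ : complexBetti S (2 * 1) →ₗ[ℂ] complexBetti S (2 * 1))
    (hΞrat : ∀ x, IsRationalClass x → IsRationalClass (Ξ x))
    (hΞ2 : ∀ x y : complexBetti S (2 * 1), cupProduct (rfl : 2 * 1 + 2 * 1 = 2 * 2) (Ξ x) (Ξ y) =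
      (2 : ℂ) • cupProduct (rfl : 2 * 1 + 2 * 1 = 2 * 2) x y)
    (hL : ∀ c : complexBetti S (2 * 1), IsRationalClass c → IsOfHodgeType 2 S (2 * 1) 1 1 c →
      c ∈ algebraicClasses S 1)
    (hX : ∀ (p : complexBetti S (2 * 2)),
      (IsIntegralClass p ∧ ∀ q : complexBetti S (2 * 2), IsIntegralClass q → ∃ n : ℤ, q = n • p) →
      ∀ (ψ : complexBetti S (2 * 1) →ₗ[ℂ] complexBetti S (2 * 1)),
        (∀ x, IsRationalClass x → IsRationalClass (ψ x)) →
        (∀ (i j : ℕ) x, IsOfHodgeType 2 S (2 * 1) i j x → IsOfHodgeType 2 S (2 * 1) i j (ψ x)) →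
        (∀ (x y : complexBetti S (2 * 1)) (a : ℂ),
          cupProduct (rfl : 2 * 1 + 2 * 1 = 2 * 2) x y = a • p →
            cupProduct (rfl : 2 * 1 + 2 * 1 = 2 * 2) (ψ x) (ψ y) = ((2 : ℂ) * a) • p) →
        ∃ γ ∈ algebraicClasses (S ⊗ S) 2, ∀ x : complexBetti S (2 * 1),
          ψ x = complexGysin μ (IsSmoothProjective.tensor_holds hS.1 hS.1) hS.1
            (SemiCartesianMonoidalCategory.fst S S)
            (rfl : 2 * 1 + 2 * 2 + 2 * 2 = 2 * 1 + 2 * (2 + 2))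
            (cupProduct (rfl : 2 * 1 + 2 * 2 = 2 * 1 + 2 * 2)
              (complexBetti.map (SemiCartesianMonoidalCategory.snd S S) (2 * 1) x) γ))
    (e : complexBetti S (2 * 1) →ₗ[ℂ] complexBetti S (2 * 1))
    (he_rat : ∀ x, IsRationalClass x → IsRationalClass (e x))
    (he_type : ∀ (i j : ℕ) x, IsOfHodgeType 2 S (2 * 1) i j x → IsOfHodgeType 2 S (2 * 1) i j (e x))
    (he_adj : ∀ x y : complexBetti S (2 * 1),
      cupProduct (rfl : 2 * 1 + 2 * 1 = 2 * 2) (e x) y = cupProduct (rfl : 2 * 1 + 2 * 1 = 2 * 2) x (e y))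
    (he_N : ∀ d ∈ algebraicClasses S 1, e d = 0)
    (he_T : ∀ x : complexBetti S (2 * 1),
      (∀ d ∈ algebraicClasses S 1, cupProduct (rfl : 2 * 1 + 2 * 1 = 2 * 2) x d = 0) →
        e (e x) = (2 : ℂ) • x) :
    ∃ γ ∈ algebraicClasses (S ⊗ S) 2, ∀ x : complexBetti S (2 * 1),
      e x = complexGysin μ (IsSmoothProjective.tensor_holds hS.1 hS.1) hS.1
        (SemiCartesianMonoidalCategory.fst S S)
        (rfl : 2 * 1 + 2 * 2 + 2 * 2 = 2 * 1 + 2 * (2 + 2))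
        (cupProduct (rfl : 2 * 1 + 2 * 2 = 2 * 1 + 2 * 2)
          (complexBetti.map (SemiCartesianMonoidalCategory.snd S S) (2 * 1) x) γ) := by
  classical
  -- the integral marking of the smooth projective surface `S`, and a Hodge model
  obtain ⟨n, η, G, p₀, hp₀, hp₀int, hp₀gen, hGt, hGdet, hηint, hηcup⟩ := exists_integralMarking hS.1
  obtain ⟨A⟩ := hS.nonempty_hodgeModel
  set Bc := Matrix.toBilin' (G.map (Int.cast : ℤ → ℂ)) with hBc
  have hBcs : Bc.IsSymm := isSymm_toBilin'_map G hGt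
  -- rational classes span: `e` vanishes as soon as it vanishes on rational classes
  have hspan : ∀ f : complexBetti S (2 * 1) →ₗ[ℂ] complexBetti S (2 * 1),
      (∀ x, IsRationalClass x → f x = 0) → ∀ x, f x = 0 := by
    intro f hf x
    rw [eq_sum_smul_integralMarking_single η x, map_sum]
    refine Finset.sum_eq_zero fun j _ => ?_
    rw [map_smul, hf _ ((hηint _).2 ⟨Pi.single j 1, η.apply_symm_apply _⟩).isRationalClass, smul_zero]
  -- if every `e x` is of type `(1,1)` then `e = 0` (Lefschetz `(1,1)`, `e|_{NS} = 0`, `e² = 2` on `NS^⊥`)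
  have hdeg : (∀ x, IsOfHodgeType 2 S (2 * 1) 1 1 (e x)) →
      ∃ γ ∈ algebraicClasses (S ⊗ S) 2, ∀ x : complexBetti S (2 * 1),
        e x = complexGysin μ (IsSmoothProjective.tensor_holds hS.1 hS.1) hS.1
          (SemiCartesianMonoidalCategory.fst S S)
          (rfl : 2 * 1 + 2 * 2 + 2 * 2 = 2 * 1 + 2 * (2 + 2))
          (cupProduct (rfl : 2 * 1 + 2 * 2 = 2 * 1 + 2 * 2)
            (complexBetti.map (SemiCartesianMonoidalCategory.snd S S) (2 * 1) x) γ) := by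
    intro h11
    -- `e (e x) = 0` for rational `x`, hence for all `x`
    have hee : ∀ x, e (e x) = 0 := fun x => by
      show (e ∘ₗ e) x = 0
      exact hspan (e ∘ₗ e) (fun x hx => show e (e x) = 0 from
        he_N _ (hL (e x) (he_rat x hx) (h11 x))) x
    -- `NS^⊥ = 0`
    have hT0 : ∀ x : complexBetti S (2 * 1),
        (∀ d ∈ algebraicClasses S 1, cupProduct (rfl : 2 * 1 + 2 * 1 = 2 * 2) x d = 0) → x = 0 := by
      intro x hx
      have h := he_T x hx
      rw [hee] at h
      exact (smul_eq_zero.1 h.symm).resolve_left two_ne_zero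
    -- `e x ∈ NS^⊥`, so `e = 0`
    have he0 : ∀ x, e x = 0 := fun x =>
      hT0 (e x) fun d hd => by rw [he_adj, he_N d hd, map_zero]
    refine ⟨0, Submodule.zero_mem _, fun x => ?_⟩
    rw [he0, map_zero, map_zero]
  by_cases h20ex : ∃ σ : complexBetti S (2 * 1), σ ≠ 0 ∧ IsOfHodgeType 2 S (2 * 1) 2 0 σ
  swap
  · /- DEGENERATE CASE `h^{2,0} = 0`: every class is of type `(1,1)`. -/
    push Not at h20ex
    have h1 : ∀ c : complexBetti S (2 * 1), IsOfHodgeType 2 S (2 * 1) 2 0 c ↔ ∃ t : ℂ, c = t • (0 : complexBetti S (2 * 1)) :=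
      fun c => ⟨fun hc => ⟨0, by rw [smul_zero]; by_contra h0; exact h20ex c h0 hc⟩,
        fun ⟨t, ht⟩ => by rw [ht, smul_zero]; exact IsOfHodgeType.zero A _ _ _⟩
    have h2 : ∀ c : complexBetti S (2 * 1), IsOfHodgeType 2 S (2 * 1) 0 2 c ↔
        ∃ t : ℂ, c = t • conjClass (ComplexPoints S) (2 * 1) (0 : complexBetti S (2 * 1)) :=
      isOfHodgeType_swap_iff_of_line hS.1 h1
    refine hdeg fun y => ?_
    obtain ⟨a, b, y₁₁, hy₁₁, hy⟩ := exists_eq_lines_add_oneOne hS.1 A h1 h2 y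
    rw [hy, conjClass_zero, smul_zero, smul_zero, zero_add, add_zero]
    exact he_type 1 1 _ hy₁₁
  /- `h^{2,0} ≠ 0`: the two lines `ℂσ`, `ℂσ̄` -/
  obtain ⟨σ, hσ0, h20⟩ := h20ex
  obtain ⟨h1, h2⟩ := hS.hodgeTypes_twoZero_zeroTwo h20 hσ0
  set σ' := conjClass (ComplexPoints S) (2 * 1) σ with hσ'
  have hσ'0 : σ' ≠ 0 := fun h0 => hσ0 (by
    rw [← conjClass_conjClass σ, ← hσ', h0, conjClass_zero])
  have h02 : IsOfHodgeType 2 S (2 * 1) 0 2 σ' := (h2 _).2 ⟨1, (one_smul ℂ _).symm⟩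
  -- `e σ = l σ`, `e σ̄ = l̄ σ̄` (a rational `e` commutes with conjugation)
  obtain ⟨l, hl⟩ := (h1 (e σ)).1 (he_type 2 0 _ h20)
  have hl' : e σ' = (starRingEnd ℂ l) • σ' := by
    rw [hσ', ← conjClass_apply_of_isRationalClass η hηint e he_rat σ, hl, conjClass_smul]
  by_cases hl0 : l = 0
  · /- CASE `e σ = e σ̄ = 0`: then every `e y` is of type `(1,1)`, so `e = 0`. -/
    have heσ : e σ = 0 := by rw [hl, hl0, zero_smul]
    have heσ' : e σ' = 0 := by rw [hl', hl0, map_zero, zero_smul]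
    refine hdeg fun y => ?_
    obtain ⟨a, b, y₁₁, hy₁₁, hy⟩ := exists_eq_lines_add_oneOne hS.1 A h1 h2 y
    rw [hy, map_add, map_add, map_smul, map_smul, heσ, heσ', smul_zero, smul_zero, zero_add, add_zero]
    exact he_type 1 1 _ hy₁₁
  · /- MAIN CASE `l ≠ 0`: `NS ⊥ σ, σ̄`, `NS ⊆ H^{1,1}`, Witt correction, X twice, `e = ½(Ξ₁ − Ξ₂)`. -/
    have hl'0 : starRingEnd ℂ l ≠ 0 := fun h => hl0 (by simpa using h)
    have horth : ∀ d ∈ algebraicClasses S 1,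
        cupProduct (rfl : 2 * 1 + 2 * 1 = 2 * 2) d σ = 0 ∧
          cupProduct (rfl : 2 * 1 + 2 * 1 = 2 * 2) d σ' = 0 := by
      intro d hd
      refine ⟨?_, ?_⟩
      · have h := he_adj d σ
        rw [he_N d hd, map_zero, LinearMap.zero_apply, hl, LinearMap.map_smul] at h
        exact (smul_eq_zero.1 h.symm).resolve_left hl0
      · have h := he_adj d σ'
        rw [he_N d hd, map_zero, LinearMap.zero_apply, hl', LinearMap.map_smul] at h
        exact (smul_eq_zero.1 h.symm).resolve_left hl'0
    -- in coordinates: `(σ.d) = (σ̄.d) = 0` for `d ∈ NS`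
    have horth' : ∀ d ∈ algebraicClasses S 1, Bc (η σ) (η d) = 0 ∧ Bc (η σ') (η d) = 0 := by
      intro d hd
      obtain ⟨hd1, hd2⟩ := horth d hd
      rw [hηcup, smul_eq_zero] at hd1 hd2
      exact ⟨by rw [hBcs.eq]; exact hd1.resolve_right hp₀, by rw [hBcs.eq]; exact hd2.resolve_right hp₀⟩
    -- divisor classes are of type `(1,1)`: they are killed by `e`
    have hN11 : ∀ d ∈ algebraicClasses S 1, IsOfHodgeType 2 S (2 * 1) 1 1 d := fun d hd =>
      isOfHodgeType_oneOne_of_ker hS.1 A h20 hσ0 h02 hσ'0 h1 h2 e he_type hl hl' hl0 hl'0 (he_N d hd)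
    -- the Witt correction from `Ξ`
    obtain ⟨m, a, b, ha, hb, -, -, hν'⟩ :=
      exists_wittCorrection hS.1 η G p₀ hp₀ hGt hGdet hηint hηcup Ξ hΞrat hΞ2 e he_rat he_adj he_N he_T
    -- the correction `ν̃ = Σᵢ (η(·)ᵀ G η(aᵢ)) bᵢ` as a linear map
    set ψ : Fin m → (complexBetti S (2 * 1) →ₗ[ℂ] complexBetti S (2 * 1)) := fun i =>
      ((Bc.flip (η (a i))) ∘ₗ η.toLinearMap).smulRight (b i) with hψdef
    have hψ : ∀ i x, ψ i x = Bc (η x) (η (a i)) • b i := by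
      intro i x
      rw [hψdef]
      change ((Bc.flip (η (a i))) ∘ₗ η.toLinearMap) x • b i = _
      rw [LinearMap.comp_apply, LinearEquiv.coe_coe, LinearMap.BilinForm.flip_apply]
    set ν : complexBetti S (2 * 1) →ₗ[ℂ] complexBetti S (2 * 1) := ∑ i, ψ i with hνdef
    have hν : ∀ x, ν x = ∑ i, Bc (η x) (η (a i)) • b i := by
      intro x
      rw [hνdef, LinearMap.sum_apply]
      exact Finset.sum_congr rfl fun i _ => hψ i x
    obtain ⟨hrat₁, hcup₁⟩ := hν' ν hν
    have heb : ∀ i, e (b i) = 0 := fun i => he_N _ (hb i)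
    have hν0 : ν σ = 0 := by
      rw [hν]
      exact Finset.sum_eq_zero fun i _ => by rw [(horth' _ (ha i)).1, zero_smul]
    have hν0' : ν σ' = 0 := by
      rw [hν]
      exact Finset.sum_eq_zero fun i _ => by rw [(horth' _ (ha i)).2, zero_smul]
    -- X at the pair `(S, S)` for `Ξ₁ = e + ν̃`
    obtain ⟨γ₁, hγ₁, hΞ₁⟩ := hX p₀ ⟨hp₀int, hp₀gen⟩ (e + ν) hrat₁
      (isOfHodgeType_add_correction' hS.1 A h1 h2 e ν he_type (fun x i => Bc (η x) (η (a i))) b hν hν0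
        hν0' (fun i => hN11 _ (hb i)))
      (fun x y c hxy => by rw [hcup₁ x y, hxy, smul_smul])
    -- X at the pair `(S, S)` for the mirror `Ξ₂ = -e + ν̃`
    obtain ⟨γ₂, hγ₂, hΞ₂⟩ := hX p₀ ⟨hp₀int, hp₀gen⟩ (-e + ν)
      (fun x hx => by
        have hx2 : (-e + ν) x = (e + ν) x + ((-2 : ℚ) : ℂ) • e x := by
          rw [LinearMap.add_apply, LinearMap.neg_apply, LinearMap.add_apply, Rat.cast_neg,
            Rat.cast_ofNat]
          module
        rw [hx2]
        exact (hrat₁ x hx).add ((he_rat x hx).smul _))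
      (isOfHodgeType_add_correction' hS.1 A h1 h2 (-e) ν
        (fun i j x hx => by rw [LinearMap.neg_apply]; exact (he_type i j x hx).neg)
        (fun x i => Bc (η x) (η (a i))) b hν hν0 hν0' (fun i => hN11 _ (hb i)))
      (fun x y c hxy => by
        rw [cupProduct_neg_add_correction_eq' e ν he_adj (fun x i => Bc (η x) (η (a i))) b hν heb x y,
          hcup₁ x y, hxy, smul_smul])
    -- `e = ½ (Ξ₁ − Ξ₂)`
    have h := induced_smul (IsSmoothProjective.tensor_holds hS.1 hS.1) hS.1
      (rfl : 2 * 1 + 2 * 2 = 2 * 1 + 2 * 2) (rfl : 2 * 1 + 2 * 2 + 2 * 2 = 2 * 1 + 2 * (2 + 2))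
      (1 / 2 : ℂ)
      (induced_sub (IsSmoothProjective.tensor_holds hS.1 hS.1) hS.1
        (rfl : 2 * 1 + 2 * 2 = 2 * 1 + 2 * 2) (rfl : 2 * 1 + 2 * 2 + 2 * 2 = 2 * 1 + 2 * (2 + 2))
        ⟨γ₁, hγ₁, hΞ₁⟩ ⟨γ₂, hγ₂, hΞ₂⟩)
    have he : (1 / 2 : ℂ) • ((e + ν) - (-e + ν)) = e := by
      rw [show (e + ν) - (-e + ν) = (2 : ℂ) • e by module, smul_smul]
      norm_num
    rwa [he] at h

end PerSurface

/-! ### The route decls from X, Lefschetz `(1,1)` and `K3TwoSelfSimilar` -/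

/-- **`RealMultiplicationSqrtTwoAlgebraic` from X = Sim₂(K3) (at the pairs `(S, S)` only),
Lefschetz `(1,1)` for K3 surfaces and the rational `2`-self-similitude of `H²` of every projective
K3 surface** (the hypothesis `hΞ`, written in the route's vocabulary with `IsK3Surface` unfolded,
ready to be inlined as a route item): `realMultiplicationSqrtTwo_algebraic_of_twoSelfSimilitude`
surface by surface. [cite: Varesco2023, Thm. 2.1 and Rem. 2.2] [cite: Huybrechts2019, §1] -/
theorem realMultiplicationSqrtTwoAlgebraic_of_twoSelfSimilar
    (hX : Theses.NikulinTwinTransport.TwinSimilitudeAlgebraic)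
    (hL : Theses.NikulinTwinTransport.LefschetzOneOneK3)
    (hΞ : ∀ (S : Literature.AlgebraicGeometry.Motives.SchemeOver ℂ),
      (Literature.AlgebraicGeometry.Motives.IsSmoothProjective 2 S ∧
        Subsingleton (Literature.AlgebraicGeometry.Motives.structureSheafCohomology S.left 1) ∧
        ∃ (A : Literature.AlgebraicGeometry.HodgeTheory.HodgeModel 2 S)
          (η : Literature.Geometry.Kaehler.MForm 𝓘(ℝ, A.model) A.carrier ℂ 2),
          Literature.Geometry.Kaehler.IsHolomorphicInCharts η ∧ ∀ x, η x ≠ 0) →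
      ∃ Ξ : Literature.AlgebraicGeometry.HodgeTheory.complexBetti S (2 * 1) →ₗ[ℂ]
          Literature.AlgebraicGeometry.HodgeTheory.complexBetti S (2 * 1),
        (∀ x, Literature.AlgebraicGeometry.HodgeTheory.IsRationalClass x →
          Literature.AlgebraicGeometry.HodgeTheory.IsRationalClass (Ξ x)) ∧
        ∀ x y : Literature.AlgebraicGeometry.HodgeTheory.complexBetti S (2 * 1),
          Literature.AlgebraicTopology.SingularHomology.cupProduct (rfl : 2 * 1 + 2 * 1 = 2 * 2) (Ξ x) (Ξ y) =
            (2 : ℂ) • Literature.AlgebraicTopology.SingularHomology.cupProduct (rfl : 2 * 1 + 2 * 1 = 2 * 2) x y) :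
    Theses.NikulinTwinTransport.RealMultiplicationSqrtTwoAlgebraic :=
  fun μ hμ S hS e he_rat he_type he_adj he_N he_T => by
    obtain ⟨Ξ, hΞrat, hΞ2⟩ := hΞ S hS
    exact realMultiplicationSqrtTwo_algebraic_of_twoSelfSimilitude μ S hS Ξ hΞrat hΞ2 (hL S hS)
      (fun p hp ψ => hX μ hμ S S hS hS p p hp hp ψ) e he_rat he_type he_adj he_N he_T

/-- **The route's glue `RealMultiplicationGlue` (item stmt-HodgeConjecture-13681) from the
rational `2`-self-similitude of `H²(K3)` ALONE** — the marking-free sharpening of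
`realMultiplicationGlue_of_marking`: of the glue's hypotheses X and Lefschetz `(1,1)` are used,
Buskin and the universal twin are not; the only extra input is `hΞ` ("`H²(S, ℚ)(2) ≅ H²(S, ℚ)`"
for every projective K3 surface `S`, in the route's vocabulary). A planner can close the item by
adding `hΞ` as a support hypothesis of the glue (or as a conjunct of `TwinExists`, whose intended
proof — marking + `EEightTwoSimilitude` — yields it): the restated glue is then
`fun hK => realMultiplicationGlue_of_twoSelfSimilar hK`. [cite: Varesco2023, Thm. 2.1 and Rem. 2.2]
[cite: Huybrechts2019, §1] -/
theorem realMultiplicationGlue_of_twoSelfSimilar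
    (hΞ : ∀ (S : Literature.AlgebraicGeometry.Motives.SchemeOver ℂ),
      (Literature.AlgebraicGeometry.Motives.IsSmoothProjective 2 S ∧
        Subsingleton (Literature.AlgebraicGeometry.Motives.structureSheafCohomology S.left 1) ∧
        ∃ (A : Literature.AlgebraicGeometry.HodgeTheory.HodgeModel 2 S)
          (η : Literature.Geometry.Kaehler.MForm 𝓘(ℝ, A.model) A.carrier ℂ 2),
          Literature.Geometry.Kaehler.IsHolomorphicInCharts η ∧ ∀ x, η x ≠ 0) →
      ∃ Ξ : Literature.AlgebraicGeometry.HodgeTheory.complexBetti S (2 * 1) →ₗ[ℂ]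
          Literature.AlgebraicGeometry.HodgeTheory.complexBetti S (2 * 1),
        (∀ x, Literature.AlgebraicGeometry.HodgeTheory.IsRationalClass x →
          Literature.AlgebraicGeometry.HodgeTheory.IsRationalClass (Ξ x)) ∧
        ∀ x y : Literature.AlgebraicGeometry.HodgeTheory.complexBetti S (2 * 1),
          Literature.AlgebraicTopology.SingularHomology.cupProduct (rfl : 2 * 1 + 2 * 1 = 2 * 2) (Ξ x) (Ξ y) =
            (2 : ℂ) • Literature.AlgebraicTopology.SingularHomology.cupProduct (rfl : 2 * 1 + 2 * 1 = 2 * 2) x y) :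
    Theses.NikulinTwinTransport.RealMultiplicationGlue :=
  fun hX _ _ hL => realMultiplicationSqrtTwoAlgebraic_of_twoSelfSimilar hX hL hΞ


/-- **The route's frame item `Assembly` (stmt-HodgeConjecture-13942, `TwinSimilitudeAlgebraic →
HodgeIsometryAlgebraic → TwinExists → LefschetzOneOneK3 → SectorComplement → HodgeConjecture`)
from `SquareGlue` and the rational `2`-self-similitude of `H²(K3)` alone** (no marking fact).
[cite: Varesco2023, Thm. 2.1 and Rem. 2.2] -/
theorem assembly_of_squareGlue_of_twoSelfSimilar
    (hSq : Theses.NikulinTwinTransport.SquareGlue)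
    (hΞ : ∀ (S : Literature.AlgebraicGeometry.Motives.SchemeOver ℂ),
      (Literature.AlgebraicGeometry.Motives.IsSmoothProjective 2 S ∧
        Subsingleton (Literature.AlgebraicGeometry.Motives.structureSheafCohomology S.left 1) ∧
        ∃ (A : Literature.AlgebraicGeometry.HodgeTheory.HodgeModel 2 S)
          (η : Literature.Geometry.Kaehler.MForm 𝓘(ℝ, A.model) A.carrier ℂ 2),
          Literature.Geometry.Kaehler.IsHolomorphicInCharts η ∧ ∀ x, η x ≠ 0) →
      ∃ Ξ : Literature.AlgebraicGeometry.HodgeTheory.complexBetti S (2 * 1) →ₗ[ℂ]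
          Literature.AlgebraicGeometry.HodgeTheory.complexBetti S (2 * 1),
        (∀ x, Literature.AlgebraicGeometry.HodgeTheory.IsRationalClass x →
          Literature.AlgebraicGeometry.HodgeTheory.IsRationalClass (Ξ x)) ∧
        ∀ x y : Literature.AlgebraicGeometry.HodgeTheory.complexBetti S (2 * 1),
          Literature.AlgebraicTopology.SingularHomology.cupProduct (rfl : 2 * 1 + 2 * 1 = 2 * 2) (Ξ x) (Ξ y) =
            (2 : ℂ) • Literature.AlgebraicTopology.SingularHomology.cupProduct (rfl : 2 * 1 + 2 * 1 = 2 * 2) x y) :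
    Theses.NikulinTwinTransport.Assembly :=
  fun hX _ _ h₁ h₇ => h₇ (hSq (realMultiplicationSqrtTwoAlgebraic_of_twoSelfSimilar hX h₁ hΞ) h₁)

/-! ### The new hypothesis follows from the marking fact -/

/-- **Markings give the rational `2`-self-similitude**: under `Huybrechts_K3_marking_exists`,
every projective K3 surface `S` carries a `ℂ`-linear `Ξ` of `H²(S(ℂ); ℂ)` preserving rational
classes with `(Ξx ∪ Ξy) = 2 (x ∪ y)` — namely `Ξ = η⁻¹ M η` for a marking `η` and the lattice
`2`-similitude `M` of `Λ_{K3}` (`exists_twoSimilitude_k3Lattice`: `U(2) ↪ U`, `E₈(2) ↪ E₈`;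
the route's proved item `EEightTwoSimilitude`). So the hypothesis of
`realMultiplicationGlue_of_twoSelfSimilar` does not enlarge the set of named facts the route rests
on (and `realMultiplicationGlue_of_twoSelfSimilar fun S hS => k3TwoSelfSimilar_of_marking h S hS`
re-proves `realMultiplicationGlue_of_marking`).
[cite: Huybrechts2016K3, Ch. 1 Prop. 3.5 and Ch. 14 §0–§1] [cite: Morrison1984, §5] -/
theorem k3TwoSelfSimilar_of_marking (hmark : Huybrechts_K3_marking_exists)
    (S : SchemeOver ℂ) (hS : IsK3Surface S) :
    ∃ Ξ : complexBetti S (2 * 1) →ₗ[ℂ] complexBetti S (2 * 1),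
      (∀ x, IsRationalClass x → IsRationalClass (Ξ x)) ∧
      ∀ x y : complexBetti S (2 * 1), cupProduct (rfl : 2 * 1 + 2 * 1 = 2 * 2) (Ξ x) (Ξ y) =
        (2 : ℂ) • cupProduct (rfl : 2 * 1 + 2 * 1 = 2 * 2) x y := by
  obtain ⟨η, p₀, _, -, ⟨-, -, hηint, hηcup, -, -⟩, -⟩ := hmark S hS
  obtain ⟨M, N, hMrat, -, -, -, hM2⟩ := exists_twoSimilitude_k3Lattice
  obtain ⟨τ, hτ⟩ := exists_ratEnd_of_forall_intCast M hMrat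
  refine ⟨η.symm.toLinearMap ∘ₗ M ∘ₗ η.toLinearMap, fun x hx => ?_, fun x y => ?_⟩
  · obtain ⟨w, hw⟩ := (isRationalClass_iff_of_marking hS η hηint x).1 hx
    refine (isRationalClass_iff_of_marking hS η hηint _).2 ⟨τ w, ?_⟩
    simp only [LinearMap.coe_comp, LinearEquiv.coe_coe, Function.comp_apply, hw, hτ w,
      LinearEquiv.apply_symm_apply]
  · simp only [LinearMap.coe_comp, LinearEquiv.coe_coe, Function.comp_apply]
    rw [hηcup, hηcup, LinearEquiv.apply_symm_apply, LinearEquiv.apply_symm_apply, hM2, smul_smul]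

end Summit.HodgeConjecture.HodgeConjecture.Theorems.NikulinTwinTransport

end
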